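import Literature.NumberTheory.LFunctions.NotAlmostMonomialSL25Characters
import HarnessLib

/-!
# Booker's counterexample `SL₂(𝔽₅)`, II: `χ₆ − χ₄` is DM-positive; `SL(2,5)` is not almost monomial

Topic `Literature/NumberTheory/LFunctions`; namespace `Literature.NumberTheory.LFunctions`, grouping
namespace `Booker2006.SL25`.  Completes the discharge of the `SL₂(𝔽₅)` clause of the named fact
`booker2006_notAlmostMonomial` (`CertifiedArtinHolomorphyCriterion.lean`; Booker, Exp. Math. 15
(2006) §2 pp. 390–391, arXiv math/0507502 Prop. 3 ff.: "That is not the case, as the counterexamples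
`GL₂(𝔽₃)` and `SL₂(𝔽₅)` show … for `ρ` the 6-dimensional representation, (2–4) fails with `χ₁`
corresponding to … `(0,0,0,0,0,0,−1,0,1)`, i.e., … one of dimension 4 can hide a pole at a zero of
`L(s, ρ)`"; printed proof: a GAP enumeration of all monomial characters):
**`Booker2006.not_isAlmostMonomial_SL25 : ¬ IsAlmostMonomial SL(2, ZMod 5)`.**

With `χ₆`, `χ₄`, `χ₁ = χ₆ − χ₄` from `NotAlmostMonomialSL25Characters.lean` (there: `χ₆`, `χ₄`
irreducible), the content is **`IsDMPositive χ₁`**: `⟨χ₁, Ind_H^G λ⟩ ≥ 0` for EVERY subgroup `H` and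
every linear character `λ` of `H`.  By Frobenius reciprocity the scalar product is
`|H|⁻¹ Σ_{h ∈ H} χ₁(h) λ(h⁻¹)`; by the kernel-certified table of subgroups
(`Literature.GroupTheory.SL25.exists_conj`) `H = y K y⁻¹` for one of twelve listed `K`, and since `χ₁`
is a class function the sum becomes `Σ_{k ∈ K} χ₁(k) λ'(k⁻¹)` with `λ'(k) = λ(y k y⁻¹)` multiplicative
on `K`.  Then (values of `χ₁` by order `1,2,3,4,5,6,10`: `2,−2,−1,0,2,1,−2`):
* `K ∈ {Q₈, SL(2,3), G}`: `−1 = [i, j]` is a commutator in `Q₈ ⊆ K`, so `λ'(−1) = 1`, and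
  `χ₁(−k) = −χ₁(k)` makes the sum vanish (`sum_eq_zero_of_central`);
* `K = ⟨c⟩` cyclic of order `m ∈ {1,2,3,4,5,6,10}`: the sum is `P_m(u) = Σ_j χ₁(cʲ) uʲ` with
  `u = λ'(c⁻¹)`, `u^m = 1`; on the roots of each cyclotomic factor of `X^m − 1` the polynomial `P_m`
  is a non-negative constant (`0, 3, 4, 6, 10, 20`; `P*_nonneg`, by `linear_combination`);
* `K` dicyclic of order `12`, `20` (`N_G(C₆)`, Borel): the listing is `⟨a⟩ ++ ⟨a⟩x`, `χ₁` vanishes on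
  the coset `⟨a⟩x` (elements of order 4), and the `⟨a⟩`-part is the cyclic case.
Assembly: `χ₆ = χ₁ + χ₄` with `χ₁, χ₄` DM-positive virtual characters, `χ₁(1) = 2`, `χ₄(1) = 4`,
contradicting Definition 2.1 for the irreducible `χ₆`.

## References
* [Booker2006] A. R. Booker, *Artin's conjecture, Turing's method, and the Riemann hypothesis*,
  Experiment. Math. 15 (2006) 385–407, §2 Definition 2.1 (p. 389), Prop. 2.3 and pp. 390–391.
* [SerreLinearRepresentations1977] J.-P. Serre, *Linear Representations of Finite Groups*, §7.2
  Thm. 13 (Frobenius reciprocity).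
* [HoltEickOBrien2005] D. F. Holt, B. Eick, E. A. O'Brien, *Handbook of Computational Group Theory*,
  §3.1 (the subgroup table replaced by `SL25.exists_conj`).
-/

noncomputable section

open scoped ComplexOrder MatrixGroups
open Finset

namespace Literature.NumberTheory.LFunctions

namespace Booker2006

namespace SL25

open Literature.RepresentationTheory.FiniteGroups Literature.GroupTheory Literature.GroupTheory.SL25
  Literature.GroupTheory.SubgroupCert

/-! ### Pure algebra: the polynomials `P_m` on `m`-th roots of unity -/

/-- `(0 : ℂ) ≤ n` for a natural number `n`. [folklore] -/
private theorem natCast_nonneg' (n : ℕ) : (0 : ℂ) ≤ (n : ℂ) := by exact_mod_cast Nat.zero_le n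

/-- `P₂(u) = 2 − 2u ≥ 0` for `u² = 1`. [cite: Booker2006, §2 p. 391] -/
private theorem P2_nonneg (u : ℂ) (hu : u ^ 2 = 1) : 0 ≤ 2 + -2 * u := by
  have hf : (u - 1) * (u + 1) = 0 := by linear_combination hu
  rcases mul_eq_zero.mp hf with h | h
  · rw [show (2 : ℂ) + -2 * u = (0 : ℕ) by push_cast; linear_combination (-2 : ℂ) * h]
    exact natCast_nonneg' _
  · rw [show (2 : ℂ) + -2 * u = (4 : ℕ) by push_cast; linear_combination (-2 : ℂ) * h]
    exact natCast_nonneg' _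

/-- `P₃(u) = 2 − u − u² ≥ 0` for `u³ = 1`. [cite: Booker2006, §2 p. 391] -/
private theorem P3_nonneg (u : ℂ) (hu : u ^ 3 = 1) : 0 ≤ 2 + -1 * u + -1 * u ^ 2 := by
  have hf : (u - 1) * (u ^ 2 + u + 1) = 0 := by linear_combination hu
  rcases mul_eq_zero.mp hf with h | h
  · rw [show (2 : ℂ) + -1 * u + -1 * u ^ 2 = (0 : ℕ) by push_cast; linear_combination (-2 - u) * h]
    exact natCast_nonneg' _
  · rw [show (2 : ℂ) + -1 * u + -1 * u ^ 2 = (3 : ℕ) by push_cast; linear_combination (-1 : ℂ) * h]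
    exact natCast_nonneg' _

/-- `P₄(u) = 2 − 2u² ≥ 0` for `u⁴ = 1`. [cite: Booker2006, §2 p. 391] -/
private theorem P4_nonneg (u : ℂ) (hu : u ^ 4 = 1) : 0 ≤ 2 + 0 * u + -2 * u ^ 2 + 0 * u ^ 3 := by
  have hf : (u ^ 2 - 1) * (u ^ 2 + 1) = 0 := by linear_combination hu
  rcases mul_eq_zero.mp hf with h | h
  · rw [show (2 : ℂ) + 0 * u + -2 * u ^ 2 + 0 * u ^ 3 = (0 : ℕ) by
      push_cast; linear_combination (-2 : ℂ) * h]
    exact natCast_nonneg' _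
  · rw [show (2 : ℂ) + 0 * u + -2 * u ^ 2 + 0 * u ^ 3 = (4 : ℕ) by
      push_cast; linear_combination (-2 : ℂ) * h]
    exact natCast_nonneg' _

/-- `P₅(u) = 2(1 + u + u² + u³ + u⁴) ≥ 0` for `u⁵ = 1`. [cite: Booker2006, §2 p. 391] -/
private theorem P5_nonneg (u : ℂ) (hu : u ^ 5 = 1) :
    0 ≤ 2 + 2 * u + 2 * u ^ 2 + 2 * u ^ 3 + 2 * u ^ 4 := by
  have hf : (u - 1) * (u ^ 4 + u ^ 3 + u ^ 2 + u + 1) = 0 := by linear_combination hu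
  rcases mul_eq_zero.mp hf with h | h
  · rw [show (2 : ℂ) + 2 * u + 2 * u ^ 2 + 2 * u ^ 3 + 2 * u ^ 4 = (10 : ℕ) by
      push_cast; linear_combination (8 + 6 * u + 4 * u ^ 2 + 2 * u ^ 3) * h]
    exact natCast_nonneg' _
  · rw [show (2 : ℂ) + 2 * u + 2 * u ^ 2 + 2 * u ^ 3 + 2 * u ^ 4 = (0 : ℕ) by
      push_cast; linear_combination (2 : ℂ) * h]
    exact natCast_nonneg' _

/-- `P₆(u) = 2 + u − u² − 2u³ − u⁴ + u⁵ ≥ 0` for `u⁶ = 1`. [cite: Booker2006, §2 p. 391] -/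
private theorem P6_nonneg (u : ℂ) (hu : u ^ 6 = 1) :
    0 ≤ 2 + 1 * u + -1 * u ^ 2 + -2 * u ^ 3 + -1 * u ^ 4 + 1 * u ^ 5 := by
  have hf : (u - 1) * (u + 1) * (u ^ 2 + u + 1) * (u ^ 2 - u + 1) = 0 := by linear_combination hu
  rcases mul_eq_zero.mp hf with h | h
  · rcases mul_eq_zero.mp h with h | h
    · rcases mul_eq_zero.mp h with h | h
      · rw [show (2 : ℂ) + 1 * u + -1 * u ^ 2 + -2 * u ^ 3 + -1 * u ^ 4 + 1 * u ^ 5 = (0 : ℕ) by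
          push_cast; linear_combination (-2 - 3 * u - 2 * u ^ 2 + u ^ 4) * h]
        exact natCast_nonneg' _
      · rw [show (2 : ℂ) + 1 * u + -1 * u ^ 2 + -2 * u ^ 3 + -1 * u ^ 4 + 1 * u ^ 5 = (0 : ℕ) by
          push_cast; linear_combination (2 - u - 2 * u ^ 3 + u ^ 4) * h]
        exact natCast_nonneg' _
    · rw [show (2 : ℂ) + 1 * u + -1 * u ^ 2 + -2 * u ^ 3 + -1 * u ^ 4 + 1 * u ^ 5 = (0 : ℕ) by
        push_cast; linear_combination (2 - u - 2 * u ^ 2 + u ^ 3) * h]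
      exact natCast_nonneg' _
  · rw [show (2 : ℂ) + 1 * u + -1 * u ^ 2 + -2 * u ^ 3 + -1 * u ^ 4 + 1 * u ^ 5 = (6 : ℕ) by
      push_cast; linear_combination (-4 - 3 * u + u ^ 3) * h]
    exact natCast_nonneg' _

/-- `P₁₀(u) = 2(1 − u)(1 + u² + u⁴ + u⁶ + u⁸) ≥ 0` for `u¹⁰ = 1`. [cite: Booker2006, §2 p. 391] -/
private theorem P10_nonneg (u : ℂ) (hu : u ^ 10 = 1) :
    0 ≤ 2 + -2 * u + 2 * u ^ 2 + -2 * u ^ 3 + 2 * u ^ 4 + -2 * u ^ 5 + 2 * u ^ 6 + -2 * u ^ 7 +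
      2 * u ^ 8 + -2 * u ^ 9 := by
  have hf : (u - 1) * (u + 1) * (u ^ 4 + u ^ 3 + u ^ 2 + u + 1) * (u ^ 4 - u ^ 3 + u ^ 2 - u + 1) = 0 := by
    linear_combination hu
  rcases mul_eq_zero.mp hf with h | h
  · rcases mul_eq_zero.mp h with h | h
    · rcases mul_eq_zero.mp h with h | h
      · rw [show (2 : ℂ) + -2 * u + 2 * u ^ 2 + -2 * u ^ 3 + 2 * u ^ 4 + -2 * u ^ 5 + 2 * u ^ 6 +
            -2 * u ^ 7 + 2 * u ^ 8 + -2 * u ^ 9 = (0 : ℕ) by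
          push_cast
          linear_combination (-2 - 2 * u ^ 2 - 2 * u ^ 4 - 2 * u ^ 6 - 2 * u ^ 8) * h]
        exact natCast_nonneg' _
      · rw [show (2 : ℂ) + -2 * u + 2 * u ^ 2 + -2 * u ^ 3 + 2 * u ^ 4 + -2 * u ^ 5 + 2 * u ^ 6 +
            -2 * u ^ 7 + 2 * u ^ 8 + -2 * u ^ 9 = (20 : ℕ) by
          push_cast
          linear_combination (-18 + 16 * u - 14 * u ^ 2 + 12 * u ^ 3 - 10 * u ^ 4 + 8 * u ^ 5 -
            6 * u ^ 6 + 4 * u ^ 7 - 2 * u ^ 8) * h]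
        exact natCast_nonneg' _
    · rw [show (2 : ℂ) + -2 * u + 2 * u ^ 2 + -2 * u ^ 3 + 2 * u ^ 4 + -2 * u ^ 5 + 2 * u ^ 6 +
          -2 * u ^ 7 + 2 * u ^ 8 + -2 * u ^ 9 = (0 : ℕ) by
        push_cast
        linear_combination (2 - 4 * u + 4 * u ^ 2 - 4 * u ^ 3 + 4 * u ^ 4 - 2 * u ^ 5) * h]
      exact natCast_nonneg' _
  · rw [show (2 : ℂ) + -2 * u + 2 * u ^ 2 + -2 * u ^ 3 + 2 * u ^ 4 + -2 * u ^ 5 + 2 * u ^ 6 +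
        -2 * u ^ 7 + 2 * u ^ 8 + -2 * u ^ 9 = (0 : ℕ) by
      push_cast
      linear_combination (2 - 2 * u ^ 5) * h]
    exact natCast_nonneg' _

/-! ### Sums over cyclic listings -/

/-- Powers of a multiplicative function along a cyclic listing: `λ'(cʲ) = λ'(c)ʲ` for `j ≤ m`
when `c⁰, …, c^{m−1} ∈ K`. [folklore] -/
private theorem theta_pow (K : List SL(2, ZMod 5)) (θ' : SL(2, ZMod 5) → ℂ) (h1 : θ' 1 = 1)
    (hmul : ∀ a ∈ K, ∀ b ∈ K, θ' (a * b) = θ' a * θ' b) (c : SL(2, ZMod 5)) (m : ℕ)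
    (hmem : ∀ j < m, c ^ j ∈ K) : ∀ j ≤ m, θ' (c ^ j) = θ' c ^ j := by
  intro j hj
  induction j with
  | zero => simp [h1]
  | succ j ih =>
    by_cases hj0 : j = 0
    · subst hj0; simp
    · rw [pow_succ, hmul _ (hmem j (by omega)) _ (by simpa using hmem 1 (by omega)), ih (by omega)]
      ring

/-- **The sum over a cyclic listing** `K = [c⁰, …, c^{m−1}]` (`c^m = 1`): for `λ'` multiplicative on
`K` with `λ'(1) = 1`, `Σ_{k ∈ K} χ₁(k) λ'(k⁻¹) = Σ_{j<m} χ₁(cʲ) uʲ` with `u = λ'(c^{m−1})`, and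
`u^m = 1`. [cite: SerreLinearRepresentations1977, §7.2] -/
private theorem cyclic_sum (c : SL(2, ZMod 5)) (m : ℕ) (hm : 0 < m) (hcm : c ^ m = 1)
    (hnd : ((List.range m).map (c ^ ·)).Nodup) (θ' : SL(2, ZMod 5) → ℂ) (h1 : θ' 1 = 1)
    (hmul : ∀ a ∈ (List.range m).map (c ^ ·), ∀ b ∈ (List.range m).map (c ^ ·),
      θ' (a * b) = θ' a * θ' b) :
    (∑ k ∈ ((List.range m).map (c ^ ·)).toFinset, chi1 k * θ' k⁻¹ =
      ∑ j ∈ Finset.range m, chi1 (c ^ j) * θ' (c ^ (m - 1)) ^ j) ∧ θ' (c ^ (m - 1)) ^ m = 1 := by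
  set K := (List.range m).map (c ^ ·) with hK
  have hmod : ∀ n, c ^ n = c ^ (n % m) := fun n => by
    conv_lhs => rw [← Nat.mod_add_div n m, pow_add, pow_mul, hcm, one_pow, mul_one]
  have hmemK : ∀ n, c ^ n ∈ K := fun n => by
    rw [hmod n]
    exact List.mem_map.mpr ⟨n % m, List.mem_range.mpr (Nat.mod_lt _ hm), rfl⟩
  set d := c ^ (m - 1) with hd
  have hdpow : ∀ i, d ^ i ∈ K := fun i => by rw [hd, ← pow_mul]; exact hmemK _
  have hθd : ∀ i ≤ m, θ' (d ^ i) = θ' d ^ i :=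
    theta_pow K θ' h1 hmul d m (fun i _ => hdpow i)
  have hcd : c * d = 1 := by
    rw [hd, ← pow_succ', Nat.sub_add_cancel hm, hcm]
  have hinv : ∀ j, (c ^ j)⁻¹ = d ^ j := fun j => by
    refine inv_eq_of_mul_eq_one_right ?_
    rw [hd, ← pow_mul, ← pow_add, show j + (m - 1) * j = m * j by
      conv_rhs => rw [← Nat.sub_add_cancel hm]
      ring]
    rw [pow_mul, hcm, one_pow]
  refine ⟨?_, ?_⟩
  · rw [List.sum_toFinset _ hnd, List.map_map]
    rw [← List.sum_toFinset _ List.nodup_range, List.toFinset_range]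
    refine Finset.sum_congr rfl fun j hj => ?_
    have hj' : j < m := Finset.mem_range.mp hj
    simp only [Function.comp_apply]
    rw [hinv j, hθd j hj'.le]
  · have hdm : d ^ m = 1 := by rw [hd, ← pow_mul, hmod, Nat.mul_mod_left, pow_zero]
    rw [← hθd m le_rfl, hdm, h1]

/-! ### The vanishing mechanism for `K ∋ −1` with `λ'(−1) = 1` -/

/-- `χ₁(−g) = −χ₁(g)`. [cite: Booker2006, §2 p. 391] -/
private theorem T1_z_mul : ∀ g : SL(2, ZMod 5), T1 (z * g) = -T1 g := by decide +kernel

/-- `(−1)² = 1`. [folklore] -/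
private theorem z_mul_z : z * z = 1 := by decide

/-- **If `−1 ∈ K`, `K` is stable under `k ↦ −k` and under inversion, and `λ'(−1) = 1`, then
`Σ_{k ∈ K} χ₁(k) λ'(k⁻¹) = 0`** (pair `k` with `−k`: `χ₁(−k) = −χ₁(k)`, `λ'((−k)⁻¹) = λ'(k⁻¹)`).
[cite: Booker2006, §2 p. 391] -/
private theorem sum_eq_zero_of_central (K : List SL(2, ZMod 5)) (hz : z ∈ K)
    (hzK : ∀ k ∈ K, z * k ∈ K) (hinvK : ∀ k ∈ K, k⁻¹ ∈ K) (θ' : SL(2, ZMod 5) → ℂ)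
    (hmul : ∀ a ∈ K, ∀ b ∈ K, θ' (a * b) = θ' a * θ' b) (hθz : θ' z = 1) :
    ∑ k ∈ K.toFinset, chi1 k * θ' k⁻¹ = 0 := by
  set S := K.toFinset
  have hS : ∀ k ∈ S, z * k ∈ S := fun k hk =>
    List.mem_toFinset.mpr (hzK k (List.mem_toFinset.mp hk))
  have h1 : ∑ k ∈ S, chi1 k * θ' k⁻¹ = ∑ k ∈ S, chi1 (z * k) * θ' (z * k)⁻¹ := by
    refine (Finset.sum_bij' (fun k _ => z * k) (fun k _ => z * k) hS hS ?_ ?_ ?_).symm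
    · intro k _; rw [← mul_assoc, z_mul_z, one_mul]
    · intro k _; rw [← mul_assoc, z_mul_z, one_mul]
    · intro k _; rfl
  have h2 : ∀ k ∈ S, chi1 (z * k) * θ' (z * k)⁻¹ = -(chi1 k * θ' k⁻¹) := by
    intro k hk
    have hk' := List.mem_toFinset.mp hk
    have hzinv : (z * k)⁻¹ = k⁻¹ * z := by
      rw [mul_inv_rev, show z⁻¹ = z from inv_eq_of_mul_eq_one_right z_mul_z]
    rw [hzinv, hmul _ (hinvK k hk') _ hz, hθz, mul_one, chi1, chi1, T1_z_mul]
    push_cast; ring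
  have h3 : ∑ k ∈ S, chi1 k * θ' k⁻¹ = -∑ k ∈ S, chi1 k * θ' k⁻¹ :=
    calc ∑ k ∈ S, chi1 k * θ' k⁻¹ = ∑ k ∈ S, chi1 (z * k) * θ' (z * k)⁻¹ := h1
      _ = ∑ k ∈ S, -(chi1 k * θ' k⁻¹) := Finset.sum_congr rfl h2
      _ = -∑ k ∈ S, chi1 k * θ' k⁻¹ := Finset.sum_neg_distrib _
  have h4 : (2 : ℂ) * ∑ k ∈ S, chi1 k * θ' k⁻¹ = 0 := by linear_combination h3
  simpa using h4

/-- `λ'(−1) = 1` whenever `i = (2 0; 0 3)`, `j = (0 1; 4 0)` and the relevant products lie in `K`: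
`−1 = i j i⁻¹ j⁻¹` is a commutator in `Q₈`. [cite: Booker2006, §2 p. 391] -/
private theorem theta_z_eq_one (K : List SL(2, ZMod 5)) (θ' : SL(2, ZMod 5) → ℂ) (h1 : θ' 1 = 1)
    (hmul : ∀ a ∈ K, ∀ b ∈ K, θ' (a * b) = θ' a * θ' b)
    (hi : m 2 0 0 3 ∈ K) (hj : m 0 1 4 0 ∈ K) (hii : m 3 0 0 2 ∈ K) (hji : m 0 4 1 0 ∈ K)
    (hij : m 0 2 2 0 ∈ K) : θ' z = 1 := by
  have e1 : z = m 0 2 2 0 * m 3 0 0 2 * m 0 4 1 0 := by decide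
  have e2 : m 0 2 2 0 = m 2 0 0 3 * m 0 1 4 0 := by decide
  have e3 : m 0 2 2 0 * m 3 0 0 2 = m 0 4 1 0 := by decide
  have e4 : m 2 0 0 3 * m 3 0 0 2 = 1 := by decide
  have e5 : m 0 1 4 0 * m 0 4 1 0 = 1 := by decide
  have hA : θ' (m 2 0 0 3) * θ' (m 3 0 0 2) = 1 := by rw [← hmul _ hi _ hii, e4, h1]
  have hB : θ' (m 0 1 4 0) * θ' (m 0 4 1 0) = 1 := by rw [← hmul _ hj _ hji, e5, h1]
  rw [e1, hmul _ (by rw [e3]; exact hji) _ hji, hmul _ hij _ hii, e2, hmul _ hi _ hj]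
  linear_combination θ' (m 0 1 4 0) * θ' (m 0 4 1 0) * hA + hB

/-! ### The twelve representatives -/

/-- `K1 = 1`. [cite: Booker2006, §2 p. 391] -/
private theorem pos_K1 (θ' : SL(2, ZMod 5) → ℂ) (h1 : θ' 1 = 1) :
    0 ≤ ∑ k ∈ K1.toFinset, chi1 k * θ' k⁻¹ := by
  have hK : K1 = [1] := by decide
  rw [hK]
  simp only [List.toFinset_cons, List.toFinset_nil, insert_empty_eq, sum_singleton, inv_one, h1,
    mul_one, chi1_one]
  exact natCast_nonneg' 2

/-- The cyclic listing `⟨c⟩`, `c = (4 0 0 4)`, order `2`: `Σ_{j<2} χ₁(cʲ) uʲ ≥ 0` for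
`u^2 = 1` (coefficients `[2, -2]`). [cite: Booker2006, §2 p. 391] -/
private theorem pos_cyc2 (θ' : SL(2, ZMod 5) → ℂ) (h1 : θ' 1 = 1)
    (hmul : ∀ a ∈ (List.range 2).map (m 4 0 0 4 ^ ·), ∀ b ∈ (List.range 2).map (m 4 0 0 4 ^ ·),
      θ' (a * b) = θ' a * θ' b) :
    0 ≤ ∑ k ∈ ((List.range 2).map (m 4 0 0 4 ^ ·)).toFinset, chi1 k * θ' k⁻¹ := by
  obtain ⟨hsum, hu⟩ := cyclic_sum (m 4 0 0 4) 2 (by norm_num) (by decide +kernel) (by decide +kernel) θ' h1 hmul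
  rw [hsum]
  have hvals : ∀ j < 2, T1 (m 4 0 0 4 ^ j) = ([2, -2] : List ℤ).getD j 0 := by decide +kernel
  rw [Finset.sum_congr rfl fun j hj => by rw [chi1, hvals j (Finset.mem_range.mp hj)]]
  simp only [Finset.sum_range_succ, Finset.sum_range_zero, List.getD_cons_succ, List.getD_cons_zero,
    zero_add, pow_zero, mul_one, pow_one]
  push_cast
  have := P2_nonneg _ hu
  convert this using 1

/-- `K2 = ⟨(4 0 0 4)⟩` (order `2`): DM-positivity of `χ₁`. [cite: Booker2006, §2 p. 391] -/
private theorem pos_K2 (θ' : SL(2, ZMod 5) → ℂ) (h1 : θ' 1 = 1)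
    (hmul : ∀ a ∈ K2, ∀ b ∈ K2, θ' (a * b) = θ' a * θ' b) :
    0 ≤ ∑ k ∈ K2.toFinset, chi1 k * θ' k⁻¹ := by
  have hK : K2 = (List.range 2).map (m 4 0 0 4 ^ ·) := by decide +kernel
  rw [hK] at hmul ⊢
  exact pos_cyc2 θ' h1 hmul

/-- The cyclic listing `⟨c⟩`, `c = (0 1 4 4)`, order `3`: `Σ_{j<3} χ₁(cʲ) uʲ ≥ 0` for
`u^3 = 1` (coefficients `[2, -1, -1]`). [cite: Booker2006, §2 p. 391] -/
private theorem pos_cyc3 (θ' : SL(2, ZMod 5) → ℂ) (h1 : θ' 1 = 1)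
    (hmul : ∀ a ∈ (List.range 3).map (m 0 1 4 4 ^ ·), ∀ b ∈ (List.range 3).map (m 0 1 4 4 ^ ·),
      θ' (a * b) = θ' a * θ' b) :
    0 ≤ ∑ k ∈ ((List.range 3).map (m 0 1 4 4 ^ ·)).toFinset, chi1 k * θ' k⁻¹ := by
  obtain ⟨hsum, hu⟩ := cyclic_sum (m 0 1 4 4) 3 (by norm_num) (by decide +kernel) (by decide +kernel) θ' h1 hmul
  rw [hsum]
  have hvals : ∀ j < 3, T1 (m 0 1 4 4 ^ j) = ([2, -1, -1] : List ℤ).getD j 0 := by decide +kernel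
  rw [Finset.sum_congr rfl fun j hj => by rw [chi1, hvals j (Finset.mem_range.mp hj)]]
  simp only [Finset.sum_range_succ, Finset.sum_range_zero, List.getD_cons_succ, List.getD_cons_zero,
    zero_add, pow_zero, mul_one, pow_one]
  push_cast
  have := P3_nonneg _ hu
  convert this using 1

/-- `K3 = ⟨(0 1 4 4)⟩` (order `3`): DM-positivity of `χ₁`. [cite: Booker2006, §2 p. 391] -/
private theorem pos_K3 (θ' : SL(2, ZMod 5) → ℂ) (h1 : θ' 1 = 1)
    (hmul : ∀ a ∈ K3, ∀ b ∈ K3, θ' (a * b) = θ' a * θ' b) :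
    0 ≤ ∑ k ∈ K3.toFinset, chi1 k * θ' k⁻¹ := by
  have hK : K3 = (List.range 3).map (m 0 1 4 4 ^ ·) := by decide +kernel
  rw [hK] at hmul ⊢
  exact pos_cyc3 θ' h1 hmul

/-- The cyclic listing `⟨c⟩`, `c = (2 0 0 3)`, order `4`: `Σ_{j<4} χ₁(cʲ) uʲ ≥ 0` for
`u^4 = 1` (coefficients `[2, 0, -2, 0]`). [cite: Booker2006, §2 p. 391] -/
private theorem pos_cyc4 (θ' : SL(2, ZMod 5) → ℂ) (h1 : θ' 1 = 1)
    (hmul : ∀ a ∈ (List.range 4).map (m 2 0 0 3 ^ ·), ∀ b ∈ (List.range 4).map (m 2 0 0 3 ^ ·),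
      θ' (a * b) = θ' a * θ' b) :
    0 ≤ ∑ k ∈ ((List.range 4).map (m 2 0 0 3 ^ ·)).toFinset, chi1 k * θ' k⁻¹ := by
  obtain ⟨hsum, hu⟩ := cyclic_sum (m 2 0 0 3) 4 (by norm_num) (by decide +kernel) (by decide +kernel) θ' h1 hmul
  rw [hsum]
  have hvals : ∀ j < 4, T1 (m 2 0 0 3 ^ j) = ([2, 0, -2, 0] : List ℤ).getD j 0 := by decide +kernel
  rw [Finset.sum_congr rfl fun j hj => by rw [chi1, hvals j (Finset.mem_range.mp hj)]]
  simp only [Finset.sum_range_succ, Finset.sum_range_zero, List.getD_cons_succ, List.getD_cons_zero,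
    zero_add, pow_zero, mul_one, pow_one]
  push_cast
  have := P4_nonneg _ hu
  convert this using 1

/-- `K4 = ⟨(2 0 0 3)⟩` (order `4`): DM-positivity of `χ₁`. [cite: Booker2006, §2 p. 391] -/
private theorem pos_K4 (θ' : SL(2, ZMod 5) → ℂ) (h1 : θ' 1 = 1)
    (hmul : ∀ a ∈ K4, ∀ b ∈ K4, θ' (a * b) = θ' a * θ' b) :
    0 ≤ ∑ k ∈ K4.toFinset, chi1 k * θ' k⁻¹ := by
  have hK : K4 = (List.range 4).map (m 2 0 0 3 ^ ·) := by decide +kernel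
  rw [hK] at hmul ⊢
  exact pos_cyc4 θ' h1 hmul

/-- The cyclic listing `⟨c⟩`, `c = (1 1 0 1)`, order `5`: `Σ_{j<5} χ₁(cʲ) uʲ ≥ 0` for
`u^5 = 1` (coefficients `[2, 2, 2, 2, 2]`). [cite: Booker2006, §2 p. 391] -/
private theorem pos_cyc5 (θ' : SL(2, ZMod 5) → ℂ) (h1 : θ' 1 = 1)
    (hmul : ∀ a ∈ (List.range 5).map (m 1 1 0 1 ^ ·), ∀ b ∈ (List.range 5).map (m 1 1 0 1 ^ ·),
      θ' (a * b) = θ' a * θ' b) :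
    0 ≤ ∑ k ∈ ((List.range 5).map (m 1 1 0 1 ^ ·)).toFinset, chi1 k * θ' k⁻¹ := by
  obtain ⟨hsum, hu⟩ := cyclic_sum (m 1 1 0 1) 5 (by norm_num) (by decide +kernel) (by decide +kernel) θ' h1 hmul
  rw [hsum]
  have hvals : ∀ j < 5, T1 (m 1 1 0 1 ^ j) = ([2, 2, 2, 2, 2] : List ℤ).getD j 0 := by decide +kernel
  rw [Finset.sum_congr rfl fun j hj => by rw [chi1, hvals j (Finset.mem_range.mp hj)]]
  simp only [Finset.sum_range_succ, Finset.sum_range_zero, List.getD_cons_succ, List.getD_cons_zero,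
    zero_add, pow_zero, mul_one, pow_one]
  push_cast
  have := P5_nonneg _ hu
  convert this using 1

/-- `K5 = ⟨(1 1 0 1)⟩` (order `5`): DM-positivity of `χ₁`. [cite: Booker2006, §2 p. 391] -/
private theorem pos_K5 (θ' : SL(2, ZMod 5) → ℂ) (h1 : θ' 1 = 1)
    (hmul : ∀ a ∈ K5, ∀ b ∈ K5, θ' (a * b) = θ' a * θ' b) :
    0 ≤ ∑ k ∈ K5.toFinset, chi1 k * θ' k⁻¹ := by
  have hK : K5 = (List.range 5).map (m 1 1 0 1 ^ ·) := by decide +kernel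
  rw [hK] at hmul ⊢
  exact pos_cyc5 θ' h1 hmul

/-- The cyclic listing `⟨c⟩`, `c = (0 1 4 1)`, order `6`: `Σ_{j<6} χ₁(cʲ) uʲ ≥ 0` for
`u^6 = 1` (coefficients `[2, 1, -1, -2, -1, 1]`). [cite: Booker2006, §2 p. 391] -/
private theorem pos_cyc6 (θ' : SL(2, ZMod 5) → ℂ) (h1 : θ' 1 = 1)
    (hmul : ∀ a ∈ (List.range 6).map (m 0 1 4 1 ^ ·), ∀ b ∈ (List.range 6).map (m 0 1 4 1 ^ ·),
      θ' (a * b) = θ' a * θ' b) :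
    0 ≤ ∑ k ∈ ((List.range 6).map (m 0 1 4 1 ^ ·)).toFinset, chi1 k * θ' k⁻¹ := by
  obtain ⟨hsum, hu⟩ := cyclic_sum (m 0 1 4 1) 6 (by norm_num) (by decide +kernel) (by decide +kernel) θ' h1 hmul
  rw [hsum]
  have hvals : ∀ j < 6, T1 (m 0 1 4 1 ^ j) = ([2, 1, -1, -2, -1, 1] : List ℤ).getD j 0 := by decide +kernel
  rw [Finset.sum_congr rfl fun j hj => by rw [chi1, hvals j (Finset.mem_range.mp hj)]]
  simp only [Finset.sum_range_succ, Finset.sum_range_zero, List.getD_cons_succ, List.getD_cons_zero,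
    zero_add, pow_zero, mul_one, pow_one]
  push_cast
  have := P6_nonneg _ hu
  convert this using 1

/-- `K6 = ⟨(0 1 4 1)⟩` (order `6`): DM-positivity of `χ₁`. [cite: Booker2006, §2 p. 391] -/
private theorem pos_K6 (θ' : SL(2, ZMod 5) → ℂ) (h1 : θ' 1 = 1)
    (hmul : ∀ a ∈ K6, ∀ b ∈ K6, θ' (a * b) = θ' a * θ' b) :
    0 ≤ ∑ k ∈ K6.toFinset, chi1 k * θ' k⁻¹ := by
  have hK : K6 = (List.range 6).map (m 0 1 4 1 ^ ·) := by decide +kernel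
  rw [hK] at hmul ⊢
  exact pos_cyc6 θ' h1 hmul

/-- The cyclic listing `⟨c⟩`, `c = (4 4 0 4)`, order `10`: `Σ_{j<10} χ₁(cʲ) uʲ ≥ 0` for
`u^10 = 1` (coefficients `[2, -2, 2, -2, 2, -2, 2, -2, 2, -2]`). [cite: Booker2006, §2 p. 391] -/
private theorem pos_cyc10 (θ' : SL(2, ZMod 5) → ℂ) (h1 : θ' 1 = 1)
    (hmul : ∀ a ∈ (List.range 10).map (m 4 4 0 4 ^ ·), ∀ b ∈ (List.range 10).map (m 4 4 0 4 ^ ·),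
      θ' (a * b) = θ' a * θ' b) :
    0 ≤ ∑ k ∈ ((List.range 10).map (m 4 4 0 4 ^ ·)).toFinset, chi1 k * θ' k⁻¹ := by
  obtain ⟨hsum, hu⟩ := cyclic_sum (m 4 4 0 4) 10 (by norm_num) (by decide +kernel) (by decide +kernel) θ' h1 hmul
  rw [hsum]
  have hvals : ∀ j < 10, T1 (m 4 4 0 4 ^ j) = ([2, -2, 2, -2, 2, -2, 2, -2, 2, -2] : List ℤ).getD j 0 := by decide +kernel
  rw [Finset.sum_congr rfl fun j hj => by rw [chi1, hvals j (Finset.mem_range.mp hj)]]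
  simp only [Finset.sum_range_succ, Finset.sum_range_zero, List.getD_cons_succ, List.getD_cons_zero,
    zero_add, pow_zero, mul_one, pow_one]
  push_cast
  have := P10_nonneg _ hu
  convert this using 1

/-- `K10 = ⟨(4 4 0 4)⟩` (order `10`): DM-positivity of `χ₁`. [cite: Booker2006, §2 p. 391] -/
private theorem pos_K10 (θ' : SL(2, ZMod 5) → ℂ) (h1 : θ' 1 = 1)
    (hmul : ∀ a ∈ K10, ∀ b ∈ K10, θ' (a * b) = θ' a * θ' b) :
    0 ≤ ∑ k ∈ K10.toFinset, chi1 k * θ' k⁻¹ := by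
  have hK : K10 = (List.range 10).map (m 4 4 0 4 ^ ·) := by decide +kernel
  rw [hK] at hmul ⊢
  exact pos_cyc10 θ' h1 hmul

/-- `K12 = ⟨a⟩ ++ ⟨a⟩x` (dicyclic, order `12`): `χ₁` vanishes on the coset `⟨a⟩x` (elements of
order `4`) and the `⟨a⟩`-part is the cyclic case of order `6`. [cite: Booker2006, §2 p. 391] -/
private theorem pos_K12 (θ' : SL(2, ZMod 5) → ℂ) (h1 : θ' 1 = 1)
    (hmul : ∀ a ∈ K12, ∀ b ∈ K12, θ' (a * b) = θ' a * θ' b) :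
    0 ≤ ∑ k ∈ K12.toFinset, chi1 k * θ' k⁻¹ := by
  have hK : K12 = (List.range 6).map (m 0 1 4 1 ^ ·) ++ K12.drop 6 := by decide +kernel
  have hsub : ∀ a ∈ (List.range 6).map (m 0 1 4 1 ^ ·), a ∈ K12 := fun a ha => by
    rw [hK]; exact List.mem_append_left _ ha
  have hzero : ∀ k ∈ K12.drop 6, T1 k = 0 := by decide +kernel
  have hdisj : Disjoint ((List.range 6).map (m 0 1 4 1 ^ ·)).toFinset (K12.drop 6).toFinset := by
    rw [Finset.disjoint_left]
    intro a ha hb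
    have h' : ∀ x ∈ ((List.range 6).map (m 0 1 4 1 ^ ·)), x ∉ (K12.drop 6) := by decide +kernel
    exact h' a (List.mem_toFinset.mp ha) (List.mem_toFinset.mp hb)
  have hmul' : ∀ a ∈ (List.range 6).map (m 0 1 4 1 ^ ·), ∀ b ∈ (List.range 6).map (m 0 1 4 1 ^ ·),
      θ' (a * b) = θ' a * θ' b := fun a ha b hb => hmul a (hsub a ha) b (hsub b hb)
  rw [hK, List.toFinset_append, Finset.sum_union hdisj]
  have h0 : ∑ k ∈ (K12.drop 6).toFinset, chi1 k * θ' k⁻¹ = 0 :=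
    Finset.sum_eq_zero fun k hk => by
      rw [chi1, hzero k (List.mem_toFinset.mp hk)]; simp
  rw [h0, add_zero]
  exact pos_cyc6 θ' h1 hmul'

/-- `K20 = ⟨a⟩ ++ ⟨a⟩x` (dicyclic, order `20`): `χ₁` vanishes on the coset `⟨a⟩x` (elements of
order `4`) and the `⟨a⟩`-part is the cyclic case of order `10`. [cite: Booker2006, §2 p. 391] -/
private theorem pos_K20 (θ' : SL(2, ZMod 5) → ℂ) (h1 : θ' 1 = 1)
    (hmul : ∀ a ∈ K20, ∀ b ∈ K20, θ' (a * b) = θ' a * θ' b) :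
    0 ≤ ∑ k ∈ K20.toFinset, chi1 k * θ' k⁻¹ := by
  have hK : K20 = (List.range 10).map (m 4 4 0 4 ^ ·) ++ K20.drop 10 := by decide +kernel
  have hsub : ∀ a ∈ (List.range 10).map (m 4 4 0 4 ^ ·), a ∈ K20 := fun a ha => by
    rw [hK]; exact List.mem_append_left _ ha
  have hzero : ∀ k ∈ K20.drop 10, T1 k = 0 := by decide +kernel
  have hdisj : Disjoint ((List.range 10).map (m 4 4 0 4 ^ ·)).toFinset (K20.drop 10).toFinset := by
    rw [Finset.disjoint_left]
    intro a ha hb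
    have h' : ∀ x ∈ ((List.range 10).map (m 4 4 0 4 ^ ·)), x ∉ (K20.drop 10) := by decide +kernel
    exact h' a (List.mem_toFinset.mp ha) (List.mem_toFinset.mp hb)
  have hmul' : ∀ a ∈ (List.range 10).map (m 4 4 0 4 ^ ·), ∀ b ∈ (List.range 10).map (m 4 4 0 4 ^ ·),
      θ' (a * b) = θ' a * θ' b := fun a ha b hb => hmul a (hsub a ha) b (hsub b hb)
  rw [hK, List.toFinset_append, Finset.sum_union hdisj]
  have h0 : ∑ k ∈ (K20.drop 10).toFinset, chi1 k * θ' k⁻¹ = 0 :=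
    Finset.sum_eq_zero fun k hk => by
      rw [chi1, hzero k (List.mem_toFinset.mp hk)]; simp
  rw [h0, add_zero]
  exact pos_cyc10 θ' h1 hmul'

/-- `K8` (`⊇ Q₈ ∋ −1 = [i, j]`): the sum vanishes. [cite: Booker2006, §2 p. 391] -/
private theorem pos_K8 (θ' : SL(2, ZMod 5) → ℂ) (h1 : θ' 1 = 1)
    (hmul : ∀ a ∈ K8, ∀ b ∈ K8, θ' (a * b) = θ' a * θ' b) :
    0 ≤ ∑ k ∈ K8.toFinset, chi1 k * θ' k⁻¹ := by
  rw [sum_eq_zero_of_central K8 (by decide) (by decide +kernel) (by decide +kernel) θ' hmul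
    (theta_z_eq_one K8 θ' h1 hmul (by decide) (by decide) (by decide) (by decide) (by decide))]

/-- `K24` (`⊇ Q₈ ∋ −1 = [i, j]`): the sum vanishes. [cite: Booker2006, §2 p. 391] -/
private theorem pos_K24 (θ' : SL(2, ZMod 5) → ℂ) (h1 : θ' 1 = 1)
    (hmul : ∀ a ∈ K24, ∀ b ∈ K24, θ' (a * b) = θ' a * θ' b) :
    0 ≤ ∑ k ∈ K24.toFinset, chi1 k * θ' k⁻¹ := by
  rw [sum_eq_zero_of_central K24 (by decide) (by decide +kernel) (by decide +kernel) θ' hmul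
    (theta_z_eq_one K24 θ' h1 hmul (by decide) (by decide) (by decide) (by decide) (by decide))]

/-- `K120` (`⊇ Q₈ ∋ −1 = [i, j]`): the sum vanishes. [cite: Booker2006, §2 p. 391] -/
private theorem pos_K120 (θ' : SL(2, ZMod 5) → ℂ) (h1 : θ' 1 = 1)
    (hmul : ∀ a ∈ K120, ∀ b ∈ K120, θ' (a * b) = θ' a * θ' b) :
    0 ≤ ∑ k ∈ K120.toFinset, chi1 k * θ' k⁻¹ := by
  rw [sum_eq_zero_of_central K120 (by decide) (by decide +kernel) (by decide +kernel) θ' hmul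
    (theta_z_eq_one K120 θ' h1 hmul (by decide) (by decide) (by decide) (by decide) (by decide))]

/-! ### DM-positivity of `χ₁` and the conclusion -/

/-- **`χ₁ = χ₆ − χ₄` is DM-positive**: `⟨χ₁, Ind_H^G λ⟩ ≥ 0` for every subgroup `H ≤ SL(2,5)` and every
linear character `λ` of `H` (Booker: "one easily checks", by GAP over all monomial `σ`; here via the
kernel-certified subgroup table `SL25.exists_conj`). [cite: Booker2006, §2 p. 391] -/
theorem isDMPositive_chi1 : IsDMPositive chi1 := by
  classical
  intro H θ
  have hcl : IsClassFun chi1 := isClassFun_of_mem_virtChars chi1_mem_virtChars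
  rw [classInner_indClassFun_right H _ hcl, classInner_apply]
  obtain ⟨K, hK, y, hH⟩ := SL25.exists_conj H
  -- the linear character transported to `G → ℂ` and to `K`
  set Θ : SL(2, ZMod 5) → ℂ := fun x => if hx : x ∈ H then ((θ ⟨x, hx⟩ : ℂˣ) : ℂ) else 0 with hΘ
  set θ' : SL(2, ZMod 5) → ℂ := fun k => Θ (y * k * y⁻¹) with hθ'
  have hΘH : ∀ x : H, ((θ x : ℂˣ) : ℂ) = Θ x := fun x => by
    simp only [hΘ, SetLike.coe_mem, dif_pos, Subtype.coe_eta]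
  have hyK : ∀ k ∈ K, y * k * y⁻¹ ∈ H := fun k hk => (hH _).mpr ⟨k, hk, rfl⟩
  have h1 : θ' 1 = 1 := by
    have e : y * 1 * y⁻¹ = 1 := by group
    simp only [hθ', hΘ, e, dif_pos H.one_mem]
    rw [show (⟨1, H.one_mem⟩ : H) = 1 from rfl, map_one, Units.val_one]
  have hmul : ∀ a ∈ K, ∀ b ∈ K, θ' (a * b) = θ' a * θ' b := by
    intro a ha b hb
    have e : y * (a * b) * y⁻¹ = (y * a * y⁻¹) * (y * b * y⁻¹) := by group
    simp only [hθ', hΘ, e, dif_pos (hyK a ha), dif_pos (hyK b hb),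
      dif_pos (H.mul_mem (hyK a ha) (hyK b hb))]
    rw [← Units.val_mul, ← map_mul]; rfl
  -- transport the sum to `K`
  have hsum : ∑ x : H, chi1 (x : SL(2, ZMod 5)) * ((θ x⁻¹ : ℂˣ) : ℂ) =
      ∑ k ∈ K.toFinset, chi1 k * θ' k⁻¹ := by
    have step1 : ∑ x : H, chi1 (x : SL(2, ZMod 5)) * ((θ x⁻¹ : ℂˣ) : ℂ) =
        ∑ x : H, (fun g : SL(2, ZMod 5) => chi1 g * Θ g⁻¹) x := by
      refine Finset.sum_congr rfl fun x _ => ?_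
      simp only [hΘH x⁻¹, Subgroup.coe_inv]
    rw [step1]
    have key := sum_subgroup_eq_sum_carrier H K y hH (fun g => chi1 g * Θ g⁻¹)
    have rhs : ∑ k ∈ K.toFinset, chi1 k * θ' k⁻¹ =
        ∑ k ∈ K.toFinset, (fun g : SL(2, ZMod 5) => chi1 g * Θ g⁻¹) (y * k * y⁻¹) := by
      refine Finset.sum_congr rfl fun k _ => ?_
      have e : (y * k * y⁻¹)⁻¹ = y * k⁻¹ * y⁻¹ := by group
      simp only [hθ', e, hcl k y]
    rw [rhs]
    convert key using 1
  rw [hsum]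
  have hcard : (0 : ℂ) ≤ (Fintype.card H : ℂ)⁻¹ := by
    rw [← Complex.ofReal_natCast, ← Complex.ofReal_inv]
    exact Complex.zero_le_real.mpr (inv_nonneg.mpr (Nat.cast_nonneg _))
  refine mul_nonneg hcard ?_
  simp only [List.mem_cons, List.mem_nil_iff, or_false] at hK
  rcases hK with rfl | rfl | rfl | rfl | rfl | rfl | rfl | rfl | rfl | rfl | rfl | rfl
  · exact pos_K1 θ' h1
  · exact pos_K2 θ' h1 hmul
  · exact pos_K3 θ' h1 hmul
  · exact pos_K4 θ' h1 hmul
  · exact pos_K5 θ' h1 hmul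
  · exact pos_K6 θ' h1 hmul
  · exact pos_K8 θ' h1 hmul
  · exact pos_K10 θ' h1 hmul
  · exact pos_K12 θ' h1 hmul
  · exact pos_K20 θ' h1 hmul
  · exact pos_K24 θ' h1 hmul
  · exact pos_K120 θ' h1 hmul

/-- **Booker 2006, §2 p. 390: `SL₂(𝔽₅)` is not almost monomial** — `Tr ρ = χ₆ = (χ₆ − χ₄) + χ₄` with
both summands non-zero DM-positive virtual characters (the printed vector `(0,0,0,0,0,0,−1,0,1)`).
[cite: Booker2006, §2 pp. 390–391] -/
theorem not_isAlmostMonomial_SL25 : ¬ IsAlmostMonomial SL(2, ZMod 5) := by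
  intro hAM
  have h := hAM chi6 isIrrChar_chi6 chi1 chi1_mem_virtChars chi4 chi4_mem_virtChars
    isDMPositive_chi1 (IsCharacter.isDMPositive isIrrChar_chi4.isCharacter) chi6_eq_add
  rcases h with h | h
  · have := congrFun h 1
    rw [chi1_one] at this
    norm_num at this
  · have := congrFun h 1
    rw [chi4_one] at this
    norm_num at this

end SL25

end Booker2006

end Literature.NumberTheory.LFunctions

end
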